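import Mathlib
import Literature.NumberTheory.Automorphic.TwistedQuotientConeClass
import Literature.NumberTheory.Automorphic.ResGLnConeDictionaryCone
import Literature.NumberTheory.Automorphic.SiegelReducedFamilies
import Summits.Langlands.Langlands.Theorems.IrreducibilityBySelfDualityHeckeEigenvalueFieldStubEquivFull
import Summits.Langlands.Langlands.Theorems.IrreducibilityBySelfDualityHeckeEigenvalueFieldStubAverage
import HarnessLib

/-!
# Re-extension of the per-coset primitives to an equivariant basic family — crux HeckeEigenvalueField
# (stmt-Langlands-13632), line Sketch, stub `stub_fam_ext` (FAM-EXT)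

Namespace `Summit.Langlands.Langlands.Theorems.HeckeEigenvalueField.Res`; theorems only.  Generic layer
`FamExt` (`Γ` acting on `W` through `a`, on `𝒢 ⧸ L` through `ι`, on `V` through `ρ`): orbit representatives
`rep` and transporters `tr` (`exists_orbit_rep_transporter`); the size `E(x) = 1 + ∑ (‖xᵢⱼ‖ + ‖x⁻¹ᵢⱼ‖)` of a
two-sided translate `A x B` is `≤ M · E(x)` (`exists_size_mul_mul_le`, `ℓ^∞`-operator norm); and
`reextend_family`: the family `β c := (tr c) ⋆ β₀ (rep c)` (twisted pull-back `TwistedQuotient.actAlt`) of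
stabiliser-invariant per-coset primitives is smooth, `Γ`-equivariant (the transporters of `c` and `γ • c`
differ by a stabiliser element), basic, satisfies `dβ_c = ω_c` (`d` commutes with the twisted pull-back —
landed AVG helper `avg_extDeriv_actAlt` — and `(tr c) ⋆ ω_{rep c} = ω_c` by equivariance and level
invariance of `ω`), with `C¹` bounds on reduced sets from those of `β₀ (rep c)` on their translates.
`stub_fam_ext` is the case `Γ = GL_n(K)`, `ι = globalEmbedding`, `ρ = σS ∘ diagArch`, `a = coneActionRat`,
`ω_c = coneForm η c` (landed EQUIV-FULL `stub_coneForm_equivariant_full`, `hω.mul_mem`).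
References: K. S. Brown, *Cohomology of Groups* (1982), III §5 [Brown1982CohomologyGroups]; A. Borel,
N. Wallach, *Continuous cohomology, discrete subgroups, …* (2000), VII 2.2–2.7 [BorelWallach2000].
-/

set_option linter.dupNamespace false -- project-wide: `Summit.Langlands.Langlands` is the mandated namespace

noncomputable section

open scoped Matrix.Norms.Operator Topology Classical Matrix TensorProduct
open Filter Set NumberField NumberField.mixedEmbedding Literature.NumberTheory.Automorphic
  Literature.NumberTheory.Automorphic.TwistedQuotient

attribute [-instance] instTopologicalSpaceMatrix
attribute [-instance] Matrix.instUniformSpace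
attribute [local instance high] NormedAddCommGroup.toSeminormedAddCommGroup

namespace Summit.Langlands.Langlands.Theorems.HeckeEigenvalueField.Res

namespace FamExt

/-- **Orbit representatives and transporters.**  For `Γ` acting on `𝒢 ⧸ L` through `ι : Γ →* 𝒢` there
are `rep : 𝒢 ⧸ L → 𝒢 ⧸ L`, constant on the `Γ`-orbits, and `tr : 𝒢 ⧸ L → Γ` with `ι (tr c) • rep c = c`
(`Quotient.out` of the orbit relation of the subgroup `ι(Γ)`, and choice). [folklore] -/
theorem exists_orbit_rep_transporter {Γ 𝒢 : Type} [Group Γ] [Group 𝒢] (ι : Γ →* 𝒢) (L : Subgroup 𝒢) :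
    ∃ (rep : 𝒢 ⧸ L → 𝒢 ⧸ L) (tr : 𝒢 ⧸ L → Γ),
      (∀ c, ι (tr c) • rep c = c) ∧ ∀ (γ : Γ) (c : 𝒢 ⧸ L), rep (ι γ • c) = rep c := by
  classical
  let s : Setoid (𝒢 ⧸ L) := MulAction.orbitRel ι.range (𝒢 ⧸ L)
  let rep : 𝒢 ⧸ L → 𝒢 ⧸ L := fun c => (Quotient.mk s c).out
  have hmem : ∀ c, ∃ γ : Γ, ι γ • rep c = c := by
    intro c
    have h : s (rep c) c := Quotient.mk_out c
    obtain ⟨⟨g, γ, rfl⟩, hg⟩ := MulAction.orbitRel_apply.1 h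
    refine ⟨γ⁻¹, ?_⟩
    rw [map_inv, inv_smul_eq_iff]
    exact hg.symm
  refine ⟨rep, fun c => Classical.choose (hmem c), fun c => Classical.choose_spec (hmem c),
    fun γ c => ?_⟩
  show (Quotient.mk s (ι γ • c)).out = (Quotient.mk s c).out
  congr 1
  exact Quotient.sound (MulAction.orbitRel_apply.2 (MulAction.mem_orbit c (⟨ι γ, γ, rfl⟩ : ι.range)))

/-- **Sizes of translates.**  For the size `E(x) = 1 + ∑ᵢⱼ (‖xᵢⱼ‖ + ‖x⁻¹ᵢⱼ‖)` and fixed `A, B` there is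
`M ≥ 1` with `E(A x B) ≤ M E(x)` for all `x` (`(A x B)⁻¹ = B⁻¹ x⁻¹ A⁻¹` over a commutative ring; entry sums
against the `ℓ^∞`-operator norm: `∑ᵢⱼ ‖(P X Q)ᵢⱼ‖ ≤ |m| ‖P‖ ‖Q‖ ∑ᵢⱼ ‖Xᵢⱼ‖`). [folklore] -/
theorem exists_size_mul_mul_le {α : Type*} [NormedCommRing α] {m : Type*} [Fintype m] [DecidableEq m]
    (A B : Matrix m m α) : ∃ M : ℝ, 1 ≤ M ∧ ∀ x : Matrix m m α,
      1 + ∑ i, ∑ j, (‖(A * x * B) i j‖ + ‖(A * x * B)⁻¹ i j‖) ≤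
        M * (1 + ∑ i, ∑ j, (‖x i j‖ + ‖x⁻¹ i j‖)) := by
  have hrow : ∀ (P : Matrix m m α) (i : m), ∑ j, ‖P i j‖ ≤ ‖P‖ := fun P i => by
    rw [Matrix.linfty_opNorm_def]
    have h : (∑ j, ‖P i j‖₊) ≤ (Finset.univ : Finset m).sup fun i => ∑ j, ‖P i j‖₊ :=
      Finset.le_sup (f := fun i => ∑ j, ‖P i j‖₊) (Finset.mem_univ i)
    simpa using NNReal.coe_le_coe.2 h
  have hle : ∀ P : Matrix m m α, ‖P‖ ≤ ∑ i, ∑ j, ‖P i j‖ := fun P => by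
    rw [Matrix.linfty_opNorm_def]
    have h : ((Finset.univ : Finset m).sup fun i => ∑ j, ‖P i j‖₊) ≤ ∑ i, ∑ j, ‖P i j‖₊ :=
      Finset.sup_le fun i _ =>
        Finset.single_le_sum (f := fun i => ∑ j, ‖P i j‖₊) (fun _ _ => bot_le) (Finset.mem_univ i)
    simpa using NNReal.coe_le_coe.2 h
  have hmul : ∀ P X Q : Matrix m m α,
      ∑ i, ∑ j, ‖(P * X * Q) i j‖ ≤ Fintype.card m * (‖P‖ * ‖Q‖) * ∑ i, ∑ j, ‖X i j‖ := by
    intro P X Q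
    calc ∑ i, ∑ j, ‖(P * X * Q) i j‖ ≤ ∑ _i : m, ‖P * X * Q‖ := Finset.sum_le_sum fun i _ => hrow _ i
      _ = Fintype.card m * ‖P * X * Q‖ := by rw [Finset.sum_const, Finset.card_univ, nsmul_eq_mul]
      _ ≤ Fintype.card m * (‖P‖ * ‖X‖ * ‖Q‖) := by
          gcongr
          exact (Matrix.linfty_opNorm_mul _ _).trans (by gcongr; exact Matrix.linfty_opNorm_mul _ _)
      _ ≤ Fintype.card m * (‖P‖ * (∑ i, ∑ j, ‖X i j‖) * ‖Q‖) := by gcongr; exact hle X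
      _ = _ := by ring
  set c₁ := (Fintype.card m : ℝ) * (‖A‖ * ‖B‖)
  set c₂ := (Fintype.card m : ℝ) * (‖B⁻¹‖ * ‖A⁻¹‖)
  have hc₁ : 0 ≤ c₁ := by positivity
  have hc₂ : 0 ≤ c₂ := by positivity
  refine ⟨1 + c₁ + c₂, by linarith, fun x => ?_⟩
  have hinv : (A * x * B)⁻¹ = B⁻¹ * x⁻¹ * A⁻¹ := by
    rw [Matrix.mul_inv_rev, Matrix.mul_inv_rev, Matrix.mul_assoc]
  simp only [Finset.sum_add_distrib]
  rw [hinv]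
  have h1 := hmul A x B
  have h2 := hmul B⁻¹ x⁻¹ A⁻¹
  have hS : 0 ≤ ∑ i, ∑ j, ‖x i j‖ := by positivity
  have hS' : 0 ≤ ∑ i, ∑ j, ‖x⁻¹ i j‖ := by positivity
  nlinarith [mul_nonneg hc₁ hS', mul_nonneg hc₂ hS, mul_nonneg hc₁ hS, mul_nonneg hc₂ hS']

/-- Bookkeeping of constants for the `C¹` bounds of the re-extended form. [folklore] -/
theorem bound {nT C M EH Ey nA P Pa Wn Wa b : ℝ} {k q : ℕ}
    (hT : 0 ≤ nT) (hM : 1 ≤ M) (hEH : 1 ≤ EH) (hEy0 : 0 ≤ Ey) (hEy : Ey ≤ M * EH)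
    (hA : 0 ≤ nA) (hP : 0 ≤ P) (hPa0 : 0 ≤ Pa) (hPa : Pa ≤ nA ^ q * P)
    (hW : 0 ≤ Wn) (hWa0 : 0 ≤ Wa) (hWa : Wa ≤ (1 + nA) * Wn) (hb : b ≤ C * Ey ^ k * Wa * Pa) :
    nT * b ≤ nT * max C 0 * M ^ k * (1 + nA) ^ (q + 1) * EH ^ k * Wn * P := by
  have hM0 : 0 ≤ M := by linarith
  have hE0 : 0 ≤ EH := by linarith
  have hC0 : 0 ≤ max C 0 := le_max_right _ _
  have h2 : Ey ^ k ≤ M ^ k * EH ^ k := by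
    rw [← mul_pow]
    exact pow_le_pow_left₀ hEy0 hEy k
  have h3 : (1 + nA) * nA ^ q ≤ (1 + nA) ^ (q + 1) := by
    rw [pow_succ']
    gcongr
    linarith
  calc nT * b ≤ nT * (max C 0 * (M ^ k * EH ^ k) * ((1 + nA) ^ (q + 1) * (Wn * P))) := by
        gcongr nT * ?_
        calc b ≤ max C 0 * Ey ^ k * Wa * Pa := hb.trans (by gcongr; exact le_max_left _ _)
          _ ≤ max C 0 * (M ^ k * EH ^ k) * ((1 + nA) * Wn) * (nA ^ q * P) := by gcongr
          _ = max C 0 * (M ^ k * EH ^ k) * (((1 + nA) * nA ^ q) * (Wn * P)) := by ring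
          _ ≤ max C 0 * (M ^ k * EH ^ k) * ((1 + nA) ^ (q + 1) * (Wn * P)) := by gcongr
    _ = nT * max C 0 * M ^ k * (1 + nA) ^ (q + 1) * EH ^ k * Wn * P := by ring

section Generic

variable {Γ 𝒢 : Type} [Group Γ] [Group 𝒢] (ι : Γ →* 𝒢) (L : Subgroup 𝒢)
  {V : Type} [NormedAddCommGroup V] [NormedSpace ℂ V] [FiniteDimensional ℂ V] (ρ : Representation ℂ Γ V)
  {W : Type} [NormedAddCommGroup W] [NormedSpace ℝ W] (a : Γ →* (W →L[ℝ] W))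

/-- **Re-extension of per-coset primitives to an equivariant basic family (generic layer).**  `ω` is a
right `L`-invariant, `Γ`-equivariant family of `(q+1)`-forms on the `Γ`-stable open `X`.  If on every coset
`cL` a smooth `q`-form `β₀ cL` is invariant under the stabiliser of `cL`, homogeneous of degree `0`,
vanishes on the Euler field, satisfies `d(β₀ cL) = ω_{cL}` on `X`, and has `C¹` bounds `≤ C E^k` on the
translates `δ · {Red p}` for a size `E ≥ 1` with `E(γ · x) ≤ M_γ E(x)`, then for orbit representatives
`rep` and transporters `tr` the family `β c := (tr c) ⋆ β₀ (rep c)` is smooth, satisfies `dβ_c = ω_c`, is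
`Γ`-EQUIVARIANT (the transporters of `c` and `ι γ • c` differ by a stabiliser element), homogeneous,
vanishes on the Euler field, and has `C¹` bounds `≤ C' E^k` on `{Red p}` (chain rule through the fixed
linear maps). [cite: Brown1982CohomologyGroups, III §5] [cite: BorelWallach2000, VII 2.2–2.7] -/
theorem reextend_family {X : Set W} (hXo : IsOpen X) (hmaps : ∀ γ : Γ, MapsTo (a γ) X X) {q : ℕ}
    (ω : 𝒢 → W → W [⋀^Fin (q + 1)]→L[ℝ] V) (hωL : ∀ c : 𝒢, ∀ u ∈ L, ω (c * u) = ω c)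
    (hωeq : ∀ (γ : Γ) (c : 𝒢), ∀ y ∈ X, ∀ v : Fin (q + 1) → W,
      ω (ι γ * c) (a γ y) (fun j => a γ (v j)) = ρ γ (ω c y v))
    {P : Type} (Red : P → W → Prop) (E : W → ℝ) (hE1 : ∀ x, 1 ≤ E x)
    (hEa : ∀ γ : Γ, ∃ Mγ : ℝ, 1 ≤ Mγ ∧ ∀ x, E (a γ x) ≤ Mγ * E x)
    (β₀ : 𝒢 ⧸ L → W → W [⋀^Fin q]→L[ℝ] V)
    (hs : ∀ cL, ContDiffOn ℝ ((⊤ : ℕ∞) : WithTop ℕ∞) (β₀ cL) X)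
    (hinv : ∀ cL (γ : Γ), ι γ • cL = cL → ∀ x ∈ X, ∀ v : Fin q → W,
      β₀ cL (a γ x) (fun i => a γ (v i)) = ρ γ (β₀ cL x v))
    (hhom : ∀ cL (r : ℝ), 0 < r → ∀ x ∈ X, ∀ v : Fin q → W,
      β₀ cL (r • x) (fun i => r • v i) = β₀ cL x v)
    (hEul : ∀ cL, ∀ x ∈ X, ∀ v : Fin q → W, (∃ i, v i = x) → β₀ cL x v = 0)
    (hd : ∀ cL, ∀ x ∈ X, extDeriv (β₀ cL) x = ω cL.out x)
    (hgr : ∀ cL (δ : Γ) (p : P), ∃ (C : ℝ) (k : ℕ), ∀ x ∈ X, Red p (a δ⁻¹ x) →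
      ∀ (v : Fin q → W) (w' : W),
        ‖β₀ cL x v‖ ≤ C * E x ^ k * ∏ i, ‖v i‖ ∧
        ‖fderiv ℝ (β₀ cL) x w' v‖ ≤ C * E x ^ k * ‖w'‖ * ∏ i, ‖v i‖) :
    ∃ β : 𝒢 ⧸ L → W → W [⋀^Fin q]→L[ℝ] V,
      (∀ c, ContDiffOn ℝ ((⊤ : ℕ∞) : WithTop ℕ∞) (β c) X) ∧
      (∀ c, ∀ x ∈ X, extDeriv (β c) x = ω c.out x) ∧
      (∀ (γ : Γ) (c : 𝒢 ⧸ L), ∀ x ∈ X, ∀ v : Fin q → W,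
        β (ι γ • c) (a γ x) (fun i => a γ (v i)) = ρ γ (β c x v)) ∧
      (∀ (c : 𝒢 ⧸ L) (r : ℝ), 0 < r → ∀ x ∈ X, ∀ v : Fin q → W,
        β c (r • x) (fun i => r • v i) = β c x v) ∧
      (∀ (c : 𝒢 ⧸ L), ∀ x ∈ X, ∀ v : Fin q → W, (∃ i, v i = x) → β c x v = 0) ∧
      ∀ (c : 𝒢 ⧸ L) (p : P), ∃ (C : ℝ) (k : ℕ), ∀ x ∈ X, Red p x → ∀ (v : Fin q → W) (w' : W),
        ‖β c x v‖ ≤ C * E x ^ k * ∏ i, ‖v i‖ ∧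
        ‖fderiv ℝ (β c) x w' v‖ ≤ C * E x ^ k * ‖w'‖ * ∏ i, ‖v i‖ := by
  classical
  obtain ⟨rep, tr, htr, hrep⟩ := exists_orbit_rep_transporter ι L
  -- the family `β c := (tr c) ⋆ β₀ (rep c)`
  obtain ⟨β, hβ⟩ : ∃ β : 𝒢 ⧸ L → W → W [⋀^Fin q]→L[ℝ] V,
      ∀ c x, β c x = TwistedQuotient.actAlt ρ a (tr c) q (β₀ (rep c) (a (tr c)⁻¹ x)) :=
    ⟨_, fun _ _ => rfl⟩
  have hβf : ∀ c, β c = fun x => TwistedQuotient.actAlt ρ a (tr c) q (β₀ (rep c) (a (tr c)⁻¹ x)) :=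
    fun c => funext (hβ c)
  refine ⟨β, fun c => ?_, fun c x hx => ?_, fun γ c x hx v => ?_, fun c r hr x hx v => ?_,
    fun c x hx v hv => ?_, fun c p => ?_⟩
  · -- smoothness on `X`
    rw [hβf c]
    exact avg_contDiffOn_actAlt ρ a hmaps (hs (rep c)) (tr c)
  · -- `dβ_c = ω_c`: `d` commutes with the twisted pull-back, `dβ₀ = ω_{rep c}`, and
    -- `(tr c) ⋆ ω_{rep c} = ω_c` (equivariance and level invariance of `ω`)
    have hy : a (tr c)⁻¹ x ∈ X := hmaps _ hx
    have hdiff : DifferentiableAt ℝ (β₀ (rep c)) (a (tr c)⁻¹ x) :=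
      ((hs (rep c)).contDiffAt (hXo.mem_nhds hy)).differentiableAt (by simp)
    rw [hβf c, avg_extDeriv_actAlt ρ a (β₀ (rep c)) (tr c) hdiff, hd (rep c) _ hy]
    obtain ⟨u, hu⟩ : ∃ u : L, c.out = ι (tr c) * (rep c).out * u := by
      have hmk : ((ι (tr c) * (rep c).out : 𝒢) : 𝒢 ⧸ L) = c :=
        (MulAction.Quotient.mk_smul_out L _ _).trans (htr c)
      obtain ⟨u, hu⟩ := QuotientGroup.mk_out_eq_mul L (ι (tr c) * (rep c).out)
      rw [hmk] at hu
      exact ⟨u, hu⟩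
    rw [hu, hωL _ _ u.2]
    ext v
    rw [TwistedQuotient.actAlt_apply]
    have key := hωeq (tr c) (rep c).out _ hy (fun i => a (tr c)⁻¹ (v i))
    simp only [TwistedQuotient.act_apply_inv] at key
    exact key.symm
  · -- equivariance: the transporters of `c` and `ι γ • c` differ by an element `σ` of the
    -- stabiliser of `rep c = rep (ι γ • c)`
    have hrc : rep (ι γ • c) = rep c := hrep γ c
    obtain ⟨σ, hσ⟩ : ∃ σ : Γ, σ = (tr (ι γ • c))⁻¹ * γ * tr c := ⟨_, rfl⟩
    have hσstab : ι σ • rep c = rep c := by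
      rw [hσ, map_mul, map_mul, map_inv, mul_smul, mul_smul, htr c, inv_smul_eq_iff, ← hrc, htr]
    have h1 : (tr (ι γ • c))⁻¹ * γ = σ * (tr c)⁻¹ := by rw [hσ]; group
    have h2 : γ * tr c = tr (ι γ • c) * σ := by rw [hσ]; group
    have hpt : ∀ w, a (tr (ι γ • c))⁻¹ (a γ w) = a σ (a (tr c)⁻¹ w) := fun w => by
      rw [← ContinuousLinearMap.comp_apply, ← ContinuousLinearMap.mul_def, ← map_mul, h1, map_mul]
      rfl
    rw [hβ, hβ, TwistedQuotient.actAlt_apply, TwistedQuotient.actAlt_apply, hrc, hpt]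
    simp only [hpt]
    rw [hinv (rep c) σ hσstab _ (hmaps _ hx), ← Module.End.mul_apply, ← map_mul, ← h2, map_mul,
      Module.End.mul_apply]
  · -- homogeneity of degree zero
    rw [hβ, hβ, TwistedQuotient.actAlt_apply, TwistedQuotient.actAlt_apply]
    simp only [map_smul]
    rw [hhom (rep c) r hr _ (hmaps _ hx)]
  · -- vanishing on the Euler field
    obtain ⟨i, hi⟩ := hv
    have hi' : a (tr c)⁻¹ (v i) = a (tr c)⁻¹ x := by rw [hi]
    rw [hβ, TwistedQuotient.actAlt_apply,
      hEul (rep c) _ (hmaps _ hx) (fun j => a (tr c)⁻¹ (v j)) ⟨i, hi'⟩, map_zero]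
  · -- growth on `{Red p}`, from the growth of `β₀ (rep c)` on the translate `(tr c)⁻¹ · {Red p}`
    obtain ⟨C, k, hCk⟩ := hgr (rep c) (tr c)⁻¹ p
    obtain ⟨M, hM1, hM⟩ := hEa (tr c)⁻¹
    refine ⟨‖TwistedQuotient.ρCLM ρ (tr c)‖ * max C 0 * M ^ k * (1 + ‖a (tr c)⁻¹‖) ^ (q + 1), k,
      fun x hx hred v w' => ?_⟩
    have hy : a (tr c)⁻¹ x ∈ X := hmaps _ hx
    have hred' : Red p (a (tr c)⁻¹⁻¹ (a (tr c)⁻¹ x)) := by rwa [TwistedQuotient.act_inv_apply]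
    obtain ⟨hb1, hb2⟩ := hCk (a (tr c)⁻¹ x) hy hred' (fun i => a (tr c)⁻¹ (v i)) (a (tr c)⁻¹ w')
    have hEy0 : 0 ≤ E (a (tr c)⁻¹ x) := zero_le_one.trans (hE1 _)
    have hPa : ∏ i, ‖a (tr c)⁻¹ (v i)‖ ≤ ‖a (tr c)⁻¹‖ ^ q * ∏ i, ‖v i‖ := by
      calc ∏ i, ‖a (tr c)⁻¹ (v i)‖ ≤ ∏ i, ‖a (tr c)⁻¹‖ * ‖v i‖ :=
            Finset.prod_le_prod (fun i _ => norm_nonneg _) fun i _ => (a (tr c)⁻¹).le_opNorm (v i)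
        _ = ‖a (tr c)⁻¹‖ ^ q * ∏ i, ‖v i‖ := by
            rw [Finset.prod_mul_distrib, Finset.prod_const, Finset.card_univ, Fintype.card_fin]
    have hPa0 : 0 ≤ ∏ i, ‖a (tr c)⁻¹ (v i)‖ := Finset.prod_nonneg fun i _ => norm_nonneg _
    have hP0 : 0 ≤ ∏ i, ‖v i‖ := Finset.prod_nonneg fun i _ => norm_nonneg _
    have hW1 : (1 : ℝ) ≤ (1 + ‖a (tr c)⁻¹‖) * 1 := by
      rw [mul_one]
      exact le_add_of_nonneg_right (norm_nonneg _)
    have hWa : ‖a (tr c)⁻¹ w'‖ ≤ (1 + ‖a (tr c)⁻¹‖) * ‖w'‖ :=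
      ((a (tr c)⁻¹).le_opNorm w').trans
        (mul_le_mul_of_nonneg_right (le_add_of_nonneg_left zero_le_one) (norm_nonneg _))
    constructor
    · -- the value
      have hb1' : ‖β₀ (rep c) (a (tr c)⁻¹ x) fun i => a (tr c)⁻¹ (v i)‖ ≤
          C * E (a (tr c)⁻¹ x) ^ k * 1 * ∏ i, ‖a (tr c)⁻¹ (v i)‖ := by rwa [mul_one]
      rw [hβ, TwistedQuotient.actAlt_apply, ← TwistedQuotient.ρCLM_apply ρ]
      refine ((TwistedQuotient.ρCLM ρ (tr c)).le_opNorm _).trans ?_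
      have h := bound (norm_nonneg (TwistedQuotient.ρCLM ρ (tr c))) hM1 (hE1 x) hEy0 (hM x)
        (norm_nonneg _) hP0 hPa0 hPa zero_le_one zero_le_one hW1 hb1'
      rwa [mul_one] at h
    · -- the derivative: chain rule through the fixed linear maps
      have hdiff : DifferentiableAt ℝ (β₀ (rep c)) (a (tr c)⁻¹ x) :=
        ((hs (rep c)).contDiffAt (hXo.mem_nhds hy)).differentiableAt (by simp)
      obtain ⟨Lpost, hL⟩ : ∃ Lpost : (W [⋀^Fin q]→L[ℝ] V) →L[ℝ] (W [⋀^Fin q]→L[ℝ] V),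
          ∀ M', Lpost M' = TwistedQuotient.actAlt ρ a (tr c) q M' :=
        ⟨(ContinuousLinearMap.compContinuousAlternatingMapCLM ℝ W V V (Fin q)
            (TwistedQuotient.ρCLM ρ (tr c))).comp
          (ContinuousAlternatingMap.compContinuousLinearMapCLM (a (tr c)⁻¹)), fun _ => rfl⟩
      have hfun : β c = fun y => Lpost (β₀ (rep c) (a (tr c)⁻¹ y)) := by
        funext y
        rw [hβ, hL]
      have hderiv : HasFDerivAt (β c)
          (Lpost.comp ((fderiv ℝ (β₀ (rep c)) (a (tr c)⁻¹ x)).comp (a (tr c)⁻¹))) x := by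
        rw [hfun]
        exact Lpost.hasFDerivAt.comp x (hdiff.hasFDerivAt.comp x (a (tr c)⁻¹).hasFDerivAt)
      rw [hderiv.fderiv, ContinuousLinearMap.comp_apply, ContinuousLinearMap.comp_apply, hL,
        TwistedQuotient.actAlt_apply, ← TwistedQuotient.ρCLM_apply ρ]
      refine ((TwistedQuotient.ρCLM ρ (tr c)).le_opNorm _).trans ?_
      exact bound (norm_nonneg _) hM1 (hE1 x) hEy0 (hM x) (norm_nonneg _) hP0 hPa0 hPa (norm_nonneg w')
        (norm_nonneg _) hWa hb2

end Generic

end FamExt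

-- the registered header is stated over these namespaces (lead's skeleton)
open ResGLnCohomology BigHeckeGLn ResGLnCone ConeDictionary SiegelFamily

set_option maxHeartbeats 800000 in
/-- **Stub FAM-EXT — re-extension of the per-coset primitives to an equivariant basic family.**  With
orbit representatives `rep` and transporters `tr` for `GL_n(K)` acting on the level cosets through
`globalEmbedding` (`globalEmbedding (tr c) • rep c = c`), `β c := (tr c) ⋆ β₂ (rep c)` (twisted pull-back by
`(tr c)⁻¹`, coefficients `σS ∘ diagArch`) is smooth, basic, `GL_n(K)`-equivariant, satisfies `dβ_c = ω_c`
(EQUIV-FULL and `hω.mul_mem`), and has `C¹` bounds on reduced sets from those of `β₂ (rep c)` on their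
translates — the generic `FamExt.reextend_family`.
[cite: Brown1982CohomologyGroups, III §5] [cite: BorelWallach2000, VII 2.2–2.7] -/
theorem stub_fam_ext {n : ℕ} {K : Type} [Field K] [NumberField K]
    (hcpt : isCompact_glFiniteIntegralLevel n K) (𝔫 : Ideal (𝓞 K))
    (π : CuspidalAutomorphicRepData n K hcpt)
    (S : Finset {w : InfinitePlace K // w.IsReal}) (lam : (K →+* ℂ) → Fin n → ℤ) {q : ℕ}
    {η : Cochain π.1 lam (q + 1)}
    (hη : η ∈ (gkComplexLS π.1 S lam).cocycles (q + 1))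
    (hω : TwistedQuotient.IsConeFormFamily (diagPos n K) (level n K 𝔫)
      (coeffRepPos ℂ n K lam)
      ((coneActionRat n K).comp (glTotPos n K).subtype) (posCone n K)
      (fun c H => coneForm π.1 S lam η c H))
    (β₂ : (FiniteAdelicGL n K ⧸ level n K 𝔫) →
      hermSpace n K → (hermSpace n K [⋀^Fin q]→L[ℝ] CoeffModule ℂ n K lam))
    (hβ₂ : ∀ cL : FiniteAdelicGL n K ⧸ level n K 𝔫,
      ContDiffOn ℝ ((⊤ : ℕ∞) : WithTop ℕ∞) (β₂ cL) (posCone n K) ∧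
      (∀ (γ : GL (Fin n) K), globalEmbedding n K γ • cL = cL →
        ∀ x ∈ posCone n K, ∀ v : Fin q → hermSpace n K,
          β₂ cL (coneActionRat n K γ x) (fun i => coneActionRat n K γ (v i)) =
            σS hcpt S lam (ParallelWeight.diagArch K n γ) (β₂ cL x v)) ∧
      (∀ (r : ℝ), 0 < r → ∀ x ∈ posCone n K, ∀ v : Fin q → hermSpace n K,
        β₂ cL (r • x) (fun i => r • v i) = β₂ cL x v) ∧
      (∀ x ∈ posCone n K, ∀ v : Fin q → hermSpace n K, (∃ i, v i = x) → β₂ cL x v = 0) ∧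
      (∀ x ∈ posCone n K,
        extDeriv (β₂ cL) x = @id (hermSpace n K [⋀^Fin (q + 1)]→L[ℝ] CoeffModule ℂ n K lam) (coneForm π.1 S lam η cL.out x)) ∧
      ∀ (δ : GL (Fin n) K) (c₁ C₁ τ₁ : ℝ), ∃ (C : ℝ) (k : ℕ), ∀ x ∈ posCone n K,
        IsReduced c₁ C₁ τ₁ n
            (placeFamily K ((coneActionRat n K δ⁻¹ x : hermSpace n K) :
              Matrix (Fin n) (Fin n) (mixedSpace K))) →
          ∀ (v : Fin q → hermSpace n K) (w' : hermSpace n K),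
            ‖β₂ cL x v‖ ≤ C * (1 + ∑ i, ∑ j,
              (‖(x : Matrix (Fin n) (Fin n) (mixedSpace K)) i j‖ +
                ‖(x : Matrix (Fin n) (Fin n) (mixedSpace K))⁻¹ i j‖)) ^ k * ∏ i, ‖v i‖ ∧
            ‖fderiv ℝ (β₂ cL) x w' v‖ ≤ C * (1 + ∑ i, ∑ j,
              (‖(x : Matrix (Fin n) (Fin n) (mixedSpace K)) i j‖ +
                ‖(x : Matrix (Fin n) (Fin n) (mixedSpace K))⁻¹ i j‖)) ^ k * ‖w'‖ * ∏ i, ‖v i‖ ) :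
    ∃ β : (FiniteAdelicGL n K ⧸ level n K 𝔫) →
        hermSpace n K → hermSpace n K [⋀^Fin q]→L[ℝ] CoeffModule ℂ n K lam,
      (∀ c, ContDiffOn ℝ ((⊤ : ℕ∞) : WithTop ℕ∞)
        (fun H => @id (hermSpace n K [⋀^Fin q]→L[ℝ] CoeffModule ℂ n K lam) (β c H))
        (posCone n K)) ∧
      (∀ c, ∀ H ∈ posCone n K,
        extDeriv (fun H' => @id (hermSpace n K [⋀^Fin q]→L[ℝ] CoeffModule ℂ n K lam)
            (β c H')) H =
          @id (hermSpace n K [⋀^Fin (q + 1)]→L[ℝ] CoeffModule ℂ n K lam)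
            (coneForm π.1 S lam η c.out H)) ∧
      (∀ (γ : GL (Fin n) K) (c : FiniteAdelicGL n K ⧸ level n K 𝔫),
        ∀ H ∈ posCone n K, ∀ v : Fin q → hermSpace n K,
        β (globalEmbedding n K γ • c) (coneActionRat n K γ H)
            (fun i => coneActionRat n K γ (v i)) =
          σS hcpt S lam (ParallelWeight.diagArch K n γ) (β c H v)) ∧
      (∀ (c : FiniteAdelicGL n K ⧸ level n K 𝔫) (r : ℝ), 0 < r →
        ∀ H ∈ posCone n K, ∀ v : Fin q → hermSpace n K,
          β c (r • H) (fun i => r • v i) = β c H v) ∧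
      (∀ (c : FiniteAdelicGL n K ⧸ level n K 𝔫),
        ∀ H ∈ posCone n K, ∀ v : Fin q → hermSpace n K, (∃ i, v i = H) → β c H v = 0) ∧
      (∀ (c : FiniteAdelicGL n K ⧸ level n K 𝔫) (c₁ C₁ τ₁ : ℝ),
        ∃ (C : ℝ) (k : ℕ), ∀ H ∈ posCone n K,
          IsReduced c₁ C₁ τ₁ n
              (placeFamily K (H : Matrix (Fin n) (Fin n) (mixedSpace K))) →
            ∀ (v : Fin q → hermSpace n K) (w' : hermSpace n K),
              ‖β c H v‖ ≤ C * (1 + ∑ i, ∑ j,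
                  (‖(H : Matrix (Fin n) (Fin n) (mixedSpace K)) i j‖ +
                    ‖(H : Matrix (Fin n) (Fin n) (mixedSpace K))⁻¹ i j‖)) ^ k * ∏ i, ‖v i‖ ∧
              ‖fderiv ℝ (fun H' => @id (hermSpace n K [⋀^Fin q]→L[ℝ]
                  CoeffModule ℂ n K lam) (β c H')) H w' v‖ ≤
                C * (1 + ∑ i, ∑ j,
                  (‖(H : Matrix (Fin n) (Fin n) (mixedSpace K)) i j‖ +
                    ‖(H : Matrix (Fin n) (Fin n) (mixedSpace K))⁻¹ i j‖)) ^ k * ‖w'‖ * ∏ i, ‖v i‖)  := by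
  classical
  have hη' : η ∈ (gkComplexLS π.1 S lam).carrier (q + 1) :=
    (((gkComplexLS π.1 S lam).mem_cocycles_iff (q + 1) η).1 hη).1
  -- the generic re-extension for `Γ = GL_n(K)` acting through `globalEmbedding`, `σS ∘ diagArch` and
  -- `coneActionRat`; `ω_c = coneForm η c` (EQUIV-FULL, level invariance); size `E` (`exists_size_mul_mul_le`
  -- for the translate `γ · x = γ_∞ x γ_∞ᴴ`); reduced sets `R(c₁, C₁, τ₁)`
  obtain ⟨β, h1, h2, h3, h4, h5, h6⟩ := FamExt.reextend_family (globalEmbedding n K) (level n K 𝔫)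
    ((σS hcpt S lam).comp
      (show GL (Fin n) K →* (AutomorphyDatum.gl n K hcpt).arch.carrier from ParallelWeight.diagArch K n))
    (coneActionRat n K) hω.isOpen (mapsTo_coneActionRat_posCone n K)
    (fun c H => coneForm π.1 S lam η c H) hω.mul_mem
    (fun γ c y hy v => stub_coneForm_equivariant_full hcpt π.1 S lam hη' γ c hy v)
    (fun (p : ℝ × ℝ × ℝ) (x : hermSpace n K) => IsReduced p.1 p.2.1 p.2.2 n
      (placeFamily K (x : Matrix (Fin n) (Fin n) (mixedSpace K))))
    (fun x : hermSpace n K => 1 + ∑ i, ∑ j,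
      (‖(x : Matrix (Fin n) (Fin n) (mixedSpace K)) i j‖ + ‖(x : Matrix (Fin n) (Fin n) (mixedSpace K))⁻¹ i j‖))
    (fun x => le_add_of_nonneg_right (by positivity))
    (fun γ => (FamExt.exists_size_mul_mul_le
        ((toMixedGL n K γ : GL (Fin n) (mixedSpace K)) : Matrix (Fin n) (Fin n) (mixedSpace K))
        ((toMixedGL n K γ : GL (Fin n) (mixedSpace K)) : Matrix (Fin n) (Fin n) (mixedSpace K))ᴴ).imp
      fun M hM => ⟨hM.1, fun x => hM.2 _⟩)
    β₂ (fun cL => (hβ₂ cL).1) (fun cL => (hβ₂ cL).2.1) (fun cL => (hβ₂ cL).2.2.1)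
    (fun cL => (hβ₂ cL).2.2.2.1) (fun cL => (hβ₂ cL).2.2.2.2.1)
    (fun cL δ p => (hβ₂ cL).2.2.2.2.2 δ p.1 p.2.1 p.2.2)
  exact ⟨β, h1, h2, h3, h4, h5, fun c c₁ C₁ τ₁ => h6 c (c₁, C₁, τ₁)⟩

end Summit.Langlands.Langlands.Theorems.HeckeEigenvalueField.Res

end
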